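import Literature.NumberTheory.GaloisRepresentations.GaloisCohomologyLayerInflationTwo
import Literature.NumberTheory.GaloisRepresentations.InfResTwoExact
import Literature.NumberTheory.GaloisRepresentations.HilbertNinetySubgroup
import Mathlib.FieldTheory.Galois.Infinite
import HarnessLib

/-!
# `H²(Gal(L/K), Lˣ) ↪ H²(K, K̄ˣ) = Br(K)`: the units layer of the finite-group engine inflates
# injectively into the tree's Galois cohomology, with image `Br(L/K) = ker(res_{Γ_L})`
# (Serre, *Local Fields* X §4 Prop. 6; *Galois Cohomology* I §2.6 (b))

Topic `NumberTheory/GaloisRepresentations`; namespace `Literature.NumberTheory.GaloisRepresentations`.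
Definitions with bodies and theorems; no named fact, no instance, no notation.  Sequel to
`GaloisCohomologyLayerInflationTwo` (`infTwo`, `infTwoOfIso`: inflation from the finite layer
`Γ_K ⧸ Γ_L ≅ Gal(L/K)` into `galoisCohomology`, degree `2`).

For a field `K : Type` of characteristic `0` and a finite Galois `L ⊆ K̄`:
* §1 `mem_of_forall_absGaloisFixingSubgroup_smul` — `K̄^{Gal(K̄/L)} = L` (infinite Galois correspondence,
  Mathlib `InfiniteGalois.fixedField_fixingSubgroup`; `K̄/K` is Galois in characteristic `0`).
* §2 **`unitsLayerEquiv K L : (K̄ˣ)^{Γ_L} ≃ₗ[ℤ] Additive Lˣ`**, equivariant along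
  `absGaloisQuotientEquiv : Γ_K ⧸ Γ_L ≃* Gal(L/K)` (`unitsLayerEquiv_equivariant`), hence
  **`unitsLayerH2Iso K L : H²(Γ_K ⧸ Γ_L, (K̄ˣ)^{Γ_L}) ≅ H²(Gal(L/K), Lˣ)`** (Mathlib `groupCohomology.mapIso`)
  onto the engine's `groupCohomology (Rep.ofAlgebraAutOnUnits K L) 2`.
* §3 **`unitsInfTwo K L : groupCohomology (Rep.ofAlgebraAutOnUnits K L) 2 →+ galoisCohomology (units K) 2`**
  and **`unitsInfTwo_injective`** (inflation–restriction in degree two, the tree's `inf_two_injective`, with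
  Hilbert 90 for `Gal(K̄/L)`, the tree's `subsingleton_one_units_galFixing`), and
  `range_unitsInfTwo_eq_ker_res` : the image is the relative Brauer group `ker (res : H²(K, K̄ˣ) → H²(Γ_L, K̄ˣ))`
  (tree `exact_inf_res_two`).

With door-c6 g9's `UnitsLayer.natCard_H2_units_eq_finrank_of_isGalois` (local fields: `|H²(Gal(L/K), Lˣ)| =
[L:K]`) and the tree's `LocalUnramifiedBrauerCyclic.exists_resKer_eq_zmultiples` (`Br(L/K)` cyclic of order
`[L:K]`, generated by the unramified class) this identifies the engine's local fundamental classes with the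
tree's Brauer classes — the local half of the "G_K bridge" (memo FINDING-door-c6-g7 §7 (G6)) for the
bsd-schneider cell (crux `AnticycControlAdditiveK`).

## References
* J.-P. Serre, *Local Fields*, GTM 67 (1979), Ch. X §4 Prop. 6 (`Br(L/K) = H²(Gal(L/K), Lˣ)`), §1 Prop. 2.
  [SerreLocalFields1979]
* J.-P. Serre, *Galois Cohomology* (1997), Ch. I §2.6 (b), Ch. II §1.1. [SerreGaloisCohomology1997]
-/

noncomputable section

open CategoryTheory groupCohomology Field

namespace Literature.NumberTheory.GaloisRepresentations

open LocalWeilDatum DiscreteGaloisModule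

attribute [local instance] absoluteGaloisGroup_compactSpace

variable (K : Type) [Field K] [CharZero K]
variable (L : IntermediateField K (AlgebraicClosure K)) [FiniteDimensional K L] [IsGalois K L]

/-! ## §1. `K̄^{Gal(K̄/L)} = L` -/

omit [FiniteDimensional K L] [IsGalois K L] in
/-- **An element of `K̄` fixed by `Gal(K̄/L)` lies in `L`** (infinite Galois correspondence for `K̄/K`,
Galois in characteristic `0`). [cite: SerreGaloisCohomology1997, II §1.1] -/
theorem mem_of_forall_absGaloisFixingSubgroup_smul [Normal K L] (x : AlgebraicClosure K)
    (hx : ∀ σ ∈ absGaloisFixingSubgroup L, σ • x = x) : x ∈ L := by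
  haveI : IsGalois K (AlgebraicClosure K) := IsGalois.mk
  rw [← InfiniteGalois.fixedField_fixingSubgroup L, IntermediateField.mem_fixedField_iff]
  intro f hf
  have h := hx ((absoluteGaloisGroup.toAlgEquiv K).symm f) (by
    rw [mem_absGaloisFixingSubgroup_iff]
    intro y hy
    rw [absoluteGaloisGroup.toAlgEquiv_symm_apply]
    exact (IntermediateField.mem_fixingSubgroup_iff _ _).1 hf y hy)
  rwa [absoluteGaloisGroup.toAlgEquiv_symm_apply] at h

/-! ## §2. `(K̄ˣ)^{Γ_L} ≅ Lˣ`, equivariantly, and the induced `H²` isomorphism -/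

omit [FiniteDimensional K L] [IsGalois K L] in
/-- The value in `K̄` of a `Γ_L`-invariant unit of `K̄` lies in `L`. [cite: SerreLocalFields1979, Ch. X §4 Prop. 6] -/
theorem coe_toMul_mem_of_invariant [Normal K L] (w : (absGaloisLayerRep K L (units K)).V) :
    ((UnitsCarrier.toAdditive w.1).toMul : AlgebraicClosure K) ∈ L := by
  refine mem_of_forall_absGaloisFixingSubgroup_smul K L _ fun σ hσ => ?_
  have h := w.2 ⟨σ, hσ⟩
  -- `h : units K σ w = w`
  have h' := congrArg (fun v : UnitsCarrier K => ((UnitsCarrier.toAdditive v).toMul : AlgebraicClosure K)) h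
  simpa only [] using (by
    change (((UnitsCarrier.toAdditive (units K σ w.1)).toMul : (AlgebraicClosure K)ˣ) :
      AlgebraicClosure K) = _ at h'
    rw [units_apply_apply, toMul_ofMul, Units.coe_smul] at h'
    exact h')

omit [FiniteDimensional K L] [IsGalois K L] in
/-- A `Γ_L`-invariant unit of `K̄` as a unit of `L`. [cite: SerreLocalFields1979, Ch. X §4 Prop. 6] -/
def toLayerUnit [Normal K L] (w : (absGaloisLayerRep K L (units K)).V) : (L : Type)ˣ :=
  Units.mk0 ⟨((UnitsCarrier.toAdditive w.1).toMul : AlgebraicClosure K), coe_toMul_mem_of_invariant K L w⟩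
    fun h => (UnitsCarrier.toAdditive w.1).toMul.ne_zero (congrArg (fun x : L => (x : AlgebraicClosure K)) h)

omit [FiniteDimensional K L] [IsGalois K L] in
/-- Unfolding: `toLayerUnit w` has the same value in `K̄`. [cite: SerreLocalFields1979, Ch. X §4 Prop. 6] -/
@[simp] theorem coe_coe_toLayerUnit [Normal K L] (w : (absGaloisLayerRep K L (units K)).V) :
    (((toLayerUnit K L w : (L : Type)ˣ) : L) : AlgebraicClosure K) =
      ((UnitsCarrier.toAdditive w.1).toMul : AlgebraicClosure K) := rfl

omit [CharZero K] [FiniteDimensional K L] [IsGalois K L] in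
/-- A unit of `L`, seen in `K̄`, is `Γ_L`-invariant. [cite: SerreLocalFields1979, Ch. X §4 Prop. 6] -/
def ofLayerUnit [Normal K L] (v : (L : Type)ˣ) : (absGaloisLayerRep K L (units K)).V :=
  ⟨UnitsCarrier.ofUnits (Units.map (algebraMap L (AlgebraicClosure K) : L →* AlgebraicClosure K) v),
    fun s => by
      change units K (s : absoluteGaloisGroup K) _ = _
      apply UnitsCarrier.toAdditive.injective
      rw [units_apply_apply]
      refine congrArg Additive.ofMul (Units.ext ?_)
      rw [Units.coe_smul]
      exact (mem_absGaloisFixingSubgroup_iff L s.1).1 s.2 _ (v : L).2⟩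

omit [CharZero K] [FiniteDimensional K L] [IsGalois K L] in
/-- Unfolding: `ofLayerUnit v` has the same value in `K̄`. [cite: SerreLocalFields1979, Ch. X §4 Prop. 6] -/
@[simp] theorem coe_toMul_ofLayerUnit [Normal K L] (v : (L : Type)ˣ) :
    ((UnitsCarrier.toAdditive (ofLayerUnit K L v).1).toMul : AlgebraicClosure K) =
      ((v : L) : AlgebraicClosure K) := rfl

omit [FiniteDimensional K L] [IsGalois K L] in
/-- **`(K̄ˣ)^{Γ_L} ≃ₗ[ℤ] Additive Lˣ`** (`(K̄ˣ)^{Gal(K̄/L)} = Lˣ`, additively written).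
[cite: SerreLocalFields1979, Ch. X §4 Prop. 6] -/
def unitsLayerEquiv [Normal K L] : (absGaloisLayerRep K L (units K)).V ≃ₗ[ℤ] Additive (L : Type)ˣ :=
  AddEquiv.toIntLinearEquiv
    { toFun := fun w => Additive.ofMul (toLayerUnit K L w)
      invFun := fun v => ofLayerUnit K L (Additive.toMul v)
      left_inv := fun _ => Subtype.ext (UnitsCarrier.toAdditive.injective
        (Additive.toMul.injective (Units.ext rfl)))
      right_inv := fun _ => Additive.toMul.injective (Units.ext (Subtype.ext rfl))
      map_add' := fun _ _ => Additive.toMul.injective (Units.ext (Subtype.ext rfl)) }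

omit [FiniteDimensional K L] [IsGalois K L] in
/-- **Equivariance**: `unitsLayerEquiv ([σ] • w) = σ|_L • unitsLayerEquiv w`.
[cite: SerreLocalFields1979, Ch. X §4 Prop. 6][cite: SerreGaloisCohomology1997, I §2.6] -/
theorem unitsLayerEquiv_equivariant [Normal K L]
    (g : absoluteGaloisGroup K ⧸ absGaloisFixingSubgroup L) :
    (unitsLayerEquiv K L).toLinearMap ∘ₗ (absGaloisLayerRep K L (units K)).ρ g =
      (Rep.ofAlgebraAutOnUnits K L).ρ (absGaloisQuotientEquiv K L g) ∘ₗ (unitsLayerEquiv K L).toLinearMap := by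
  induction g using QuotientGroup.induction_on with
  | H σ =>
    apply LinearMap.ext
    intro w
    refine Additive.toMul.injective (Units.ext (Subtype.ext ?_))
    -- both sides have value `σ • w` in `K̄`
    change ((UnitsCarrier.toAdditive (units K σ w.1)).toMul : AlgebraicClosure K) =
      ((absGaloisQuotientEquiv K L (σ : absoluteGaloisGroup K ⧸ absGaloisFixingSubgroup L) •
        toLayerUnit K L w : (L : Type)ˣ) : L)
    rw [units_apply_apply, toMul_ofMul, Units.coe_smul, AlgEquiv.smul_units_def, Units.coe_map,
      MonoidHom.coe_coe, coe_absGaloisQuotientEquiv_mk_apply]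
    rfl

/-- **`H²(Γ_K ⧸ Γ_L, (K̄ˣ)^{Γ_L}) ≅ H²(Gal(L/K), Lˣ)`** onto the engine's units layer
(Mathlib `groupCohomology.mapIso` along `absGaloisQuotientEquiv` and `unitsLayerEquiv`).
[cite: SerreLocalFields1979, Ch. X §4 Prop. 6] -/
def unitsLayerH2Iso :
    groupCohomology (absGaloisLayerRep K L (units K)) 2 ≅ groupCohomology (Rep.ofAlgebraAutOnUnits K L) 2 :=
  groupCohomology.mapIso (absGaloisQuotientEquiv K L) (unitsLayerEquiv K L)
    (unitsLayerEquiv_equivariant K L) 2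

/-! ## §3. Inflation of the units layer into `H²(K, K̄ˣ)`: injective, image `Br(L/K)` -/

/-- **`inf : H²(Gal(L/K), Lˣ) → H²(K, K̄ˣ)`** from the engine's units layer.
[cite: SerreLocalFields1979, Ch. X §4 Prop. 6][cite: SerreGaloisCohomology1997, I §2.6] -/
def unitsInfTwo : groupCohomology (Rep.ofAlgebraAutOnUnits K L) 2 →+ galoisCohomology (units K) 2 :=
  infTwoOfIso K L (units K) (unitsLayerH2Iso K L)

/-- `unitsInfTwo ∘ unitsLayerH2Iso = infTwo`. [cite: SerreGaloisCohomology1997, I §2.6] -/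
theorem unitsInfTwo_apply_hom (x : groupCohomology (absGaloisLayerRep K L (units K)) 2) :
    unitsInfTwo K L ((unitsLayerH2Iso K L).hom x) = infTwo K L (units K) x :=
  infTwoOfIso_apply_hom K L (units K) (unitsLayerH2Iso K L) x

omit [CharZero K] [FiniteDimensional K L] in
/-- Hilbert 90 for `Γ_L = Gal(K̄/L) ≤ Γ_K` on `K̄ˣ`, at the tree's `absGaloisFixingSubgroup L`.
[cite: SerreLocalFields1979, Ch. X §1 Prop. 2] -/
theorem subsingleton_one_units_absGaloisFixingSubgroup :
    Subsingleton (continuousCohomology 1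
      (((units K).restrict (subgroupIncl (absGaloisFixingSubgroup L))).toTopRep)) := by
  rw [← galFixing_eq_absGaloisFixingSubgroup]
  exact subsingleton_one_units_galFixing L

omit [CharZero K] in
/-- **The inflation `H²(Γ_K ⧸ Γ_L, (K̄ˣ)^{Γ_L}) → H²(K, K̄ˣ)` is injective** (inflation–restriction in degree
two with `H¹(Γ_L, K̄ˣ) = 0`). [cite: SerreGaloisCohomology1997, I §2.6 (b)][cite: SerreLocalFields1979, Ch. X §4 Prop. 6] -/
theorem infTwo_units_injective : Function.Injective (infTwo K L (units K)) := by
  haveI : IsClosed ((absGaloisFixingSubgroup L : Subgroup (absoluteGaloisGroup K)) :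
      Set (absoluteGaloisGroup K)) :=
    (absGaloisFixingSubgroup L).isClosed_of_isOpen (isOpen_absGaloisFixingSubgroup K L)
  have h := inf_two_injective (absGaloisFixingSubgroup L) (units K)
    (subsingleton_one_units_absGaloisFixingSubgroup K L)
  -- `infTwo = inf ∘ layerH2Equiv` and the tree's two inflations agree definitionally
  intro x y hxy
  apply (absGaloisLayerH2Equiv K L (units K)).injective
  exact h hxy

/-- **`unitsInfTwo : H²(Gal(L/K), Lˣ) ↪ H²(K, K̄ˣ)` is injective.** [cite: SerreLocalFields1979, Ch. X §4 Prop. 6] -/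
theorem unitsInfTwo_injective : Function.Injective (unitsInfTwo K L) := by
  intro x y hxy
  obtain ⟨x', rfl⟩ : ∃ x', (unitsLayerH2Iso K L).hom x' = x :=
    ⟨(unitsLayerH2Iso K L).inv x, Iso.inv_hom_id_apply _ x⟩
  obtain ⟨y', rfl⟩ : ∃ y', (unitsLayerH2Iso K L).hom y' = y :=
    ⟨(unitsLayerH2Iso K L).inv y, Iso.inv_hom_id_apply _ y⟩
  rw [unitsInfTwo_apply_hom, unitsInfTwo_apply_hom] at hxy
  rw [infTwo_units_injective K L hxy]

/-- **The image of `unitsInfTwo` is the relative Brauer group `Br(L/K) = ker(res_{Γ_L})`**: a class of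
`H²(K, K̄ˣ)` is inflated from `H²(Gal(L/K), Lˣ)` iff it dies on `Γ_L = Gal(K̄/L)` (inflation–restriction
in degree two, the tree's `exact_inf_res_two`). [cite: SerreLocalFields1979, Ch. X §4 Prop. 6]
[cite: SerreGaloisCohomology1997, I §2.6 (b)] -/
theorem mem_range_unitsInfTwo_iff (c : galoisCohomology (units K) 2) :
    c ∈ Set.range (unitsInfTwo K L) ↔ (resH (absGaloisFixingSubgroup L) (units K) 2).hom c = 0 := by
  haveI : IsClosed ((absGaloisFixingSubgroup L : Subgroup (absoluteGaloisGroup K)) :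
      Set (absoluteGaloisGroup K)) :=
    (absGaloisFixingSubgroup L).isClosed_of_isOpen (isOpen_absGaloisFixingSubgroup K L)
  rw [exact_inf_res_two (absGaloisFixingSubgroup L) (units K)
    (subsingleton_one_units_absGaloisFixingSubgroup K L) c]
  constructor
  · rintro ⟨x, rfl⟩
    obtain ⟨x', rfl⟩ : ∃ x', (unitsLayerH2Iso K L).hom x' = x :=
      ⟨(unitsLayerH2Iso K L).inv x, Iso.inv_hom_id_apply _ x⟩
    rw [unitsInfTwo_apply_hom]
    exact ⟨absGaloisLayerH2Equiv K L (units K) x', rfl⟩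
  · rintro ⟨z, hz⟩
    refine ⟨(unitsLayerH2Iso K L).hom ((absGaloisLayerH2Equiv K L (units K)).symm z), ?_⟩
    rw [unitsInfTwo_apply_hom, ← hz]
    change galoisCohomology.inf (units K) _ 2
      (absGaloisLayerH2Equiv K L (units K) ((absGaloisLayerH2Equiv K L (units K)).symm z)) = _
    rw [LinearEquiv.apply_symm_apply]
    rfl

end Literature.NumberTheory.GaloisRepresentations

end
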